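import Summits.ValiantsHypothesis.ValiantsHypothesis.Theorems.KPlusLogSqLawOctaveDominatedClasses

/-!
# Route «KPlusLogSqLaw», octave line — depth-free direction, step 3: the LIVE envelope — `root_near_liveBreaks`, `octaveCount_le_liveBreaks` (PROVED under `LiveDepthLE`), `LiveBreaksBound` (typed, NOT asserted) and `deadClassLifting_of_liveBreaksBound`

HONEST FRAMING.  Prover seat val-width-19561-oc1 (re-target by director-valiant g9, 2026-08-27T23:36:52Z: «THEORY on the first depth-FREE piece toward Ω-W»), `--supports stmt-ValiantsHypothesis-19561`.  `OctaveWeakLifting` (Ω-W) is depth-free and OPEN; `WeakLifting` (stmt-19561), `TropicalB` (stmt-19771), Conjecture B are OPEN; the candidate statements `DeadClassLifting` and `NewtonBreakLifting` are DEFINED, NOT asserted.  Nothing here bears on their truth; VP ≠ VNP is not moved.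

This file: `IsLiveTerm`, `liveBreaks` (breakpoints of the envelope of LIVE raw lines), `LiveBreaksBound` (NOT asserted), `sum_deadClass_terms_eq_zero`, `eval_pencilDet_eq_sum_live`, `root_near_liveBreaks`, `octaveCount_le_liveBreaks`, `deadClassLifting_of_liveBreaksBound` — dead-class lifting = (archimedean half, proved here) + (live-breaks vs tropical row, open).
-/

set_option linter.dupNamespace false
set_option autoImplicit false

namespace Summit.ValiantsHypothesis.ValiantsHypothesis.Theorems.KPlusLogSqLaw.Octave

open Polynomial Finset
open scoped BigOperators

/-! ## Depth-free direction, step 3 (val-width-19561-oc1): the LIVE envelope — dead classes are quotiented out of the confinement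

HONEST FRAMING.  Under `LiveDepthLE Δ` (depth `≤ Δ` on live classes only, dead classes free) the archimedean half of the rung survives
verbatim once the design envelope is replaced by the LIVE envelope `θ ↦ max_{τ live} rawLine τ θ` (raw lines of terms whose slope class
has a nonzero coefficient): every nonzero real root has `log₂|x|` within `m(⌊log₂(mK)⌋+1) + Δ` of a LIVE breakpoint
(`root_near_liveBreaks`), hence `octaveCount ≤ (2(M+Δ)+2) · #liveBreaks` (`octaveCount_le_liveBreaks`).  What is NOT proved and is
typed as `LiveBreaksBound` (NOT asserted): `TropRowD m K n ⇒ #liveBreaks ≤ n`.  This is the MASKING question in pure form — the live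
class-tops are a SUBSET of the class-tops (the dead hull vertices are deleted and their pockets re-convexified), and sub-hulls are not
controlled by the full-hull count in general (for `m = 2` the class-tops lie in Minkowski sums of the letters' point sets, which contain
convexly independent subsets of size ≫ K); whether DEAD (exactly cancelling) classes can realise such pockets is open.
`deadClassLifting_of_liveBreaksBound` records the reduction.  Nothing here bears on Ω-W / B / TB; VP ≠ VNP is not moved. -/

section LiveEnvelope

open Finset

variable {m K : ℕ}

/-- a raw term is LIVE: it is present and its slope class has a nonzero coefficient in `det`. -/
def IsLiveTerm (d : Fin K → ℕ) (S : Fin K → Matrix (Fin m) (Fin m) ℝ) (τ : RawTerm m K) : Prop :=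
  rawCoef S τ ≠ 0 ∧ (pencilDet d S).coeff (rawSlope d τ) ≠ 0

open scoped Classical in
/-- **live breakpoints**: abscissae where two LIVE raw lines of distinct slopes tie at the top of the live envelope
`θ ↦ max_{τ live} rawLine τ θ` (the design envelope with the dead classes deleted). -/
noncomputable def liveBreaks (d : Fin K → ℕ) (S : Fin K → Matrix (Fin m) (Fin m) ℝ) : Finset ℝ :=
  ((Finset.univ : Finset (RawTerm m K × RawTerm m K)).filter (fun kl =>
      IsLiveTerm d S kl.1 ∧ IsLiveTerm d S kl.2 ∧ rawSlope d kl.1 ≠ rawSlope d kl.2 ∧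
        ∀ t : RawTerm m K, IsLiveTerm d S t → rawLine d S t (rawCross d S kl) ≤ rawLine d S kl.1 (rawCross d S kl))).image
    (rawCross d S)

/-- **live-breaks bound** (DEFINED, NOT asserted — the masking question in pure form): the unsigned tropical row bounds the number of
breakpoints of the LIVE envelope of every real pencil of the format.  With `octaveCount_le_liveBreaks` it would give `DeadClassLifting`
(`deadClassLifting_of_liveBreaksBound`).  Why it might fail: live class-tops are a SUBSET of the class-tops; deleting a dead hull vertex
re-convexifies a pocket, and sub-hull vertex counts are not controlled by full-hull counts. -/
def LiveBreaksBound : Prop :=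
  ∀ (m K n : ℕ), Summit.ValiantsHypothesis.ValiantsHypothesis.Theorems.KPlusLogSqLaw.TropRowD m K n →
    ∀ (d : Fin K → ℕ) (S : Fin K → Matrix (Fin m) (Fin m) ℝ), (liveBreaks d S).card ≤ n

/-- the raw terms of the classes with vanishing coefficient contribute nothing to `f(x)`: class by class they sum to the (zero)
coefficient. [folklore] -/
theorem sum_deadClass_terms_eq_zero (d : Fin K → ℕ) (S : Fin K → Matrix (Fin m) (Fin m) ℝ) (x : ℝ) :
    ∑ τ ∈ univ.filter (fun τ : RawTerm m K => (pencilDet d S).coeff (rawSlope d τ) = 0), rawCoef S τ * x ^ rawSlope d τ = 0 := by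
  classical
  set D := univ.filter (fun τ : RawTerm m K => (pencilDet d S).coeff (rawSlope d τ) = 0) with hD
  rw [← Finset.sum_fiberwise_of_maps_to (s := D) (t := D.image (rawSlope d)) (g := rawSlope d)
    (fun τ hτ => mem_image_of_mem _ hτ)]
  refine Finset.sum_eq_zero fun e he => ?_
  obtain ⟨τe, hτe, rfl⟩ := mem_image.1 he
  have hc : (pencilDet d S).coeff (rawSlope d τe) = 0 := (mem_filter.1 hτe).2
  have hfib : D.filter (fun τ => rawSlope d τ = rawSlope d τe) = univ.filter (fun τ => rawSlope d τ = rawSlope d τe) := by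
    ext τ
    simp only [hD, mem_filter, mem_univ, true_and]
    constructor
    · exact fun h => h.2
    · intro h; exact ⟨by rw [h]; exact hc, h⟩
  rw [hfib]
  calc ∑ τ ∈ univ.filter (fun τ => rawSlope d τ = rawSlope d τe), rawCoef S τ * x ^ rawSlope d τ
      = ∑ τ ∈ univ.filter (fun τ => rawSlope d τ = rawSlope d τe), rawCoef S τ * x ^ rawSlope d τe :=
        Finset.sum_congr rfl fun τ hτ => by rw [(mem_filter.1 hτ).2]
    _ = (∑ τ ∈ univ.filter (fun τ => rawSlope d τ = rawSlope d τe), rawCoef S τ) * x ^ rawSlope d τe := by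
        rw [Finset.sum_mul]
    _ = 0 := by rw [← coeff_pencilDet_eq_sum, hc, zero_mul]

/-- hence `f(x)` is the sum of its LIVE-class raw terms. [folklore] -/
theorem eval_pencilDet_eq_sum_live (d : Fin K → ℕ) (S : Fin K → Matrix (Fin m) (Fin m) ℝ) (x : ℝ) :
    (pencilDet d S).eval x =
      ∑ τ : RawTerm m K, (if (pencilDet d S).coeff (rawSlope d τ) = 0 then 0 else rawCoef S τ) * x ^ rawSlope d τ := by
  classical
  rw [eval_pencilDet_eq_sum]
  have hsplit := Finset.sum_filter_add_sum_filter_not univ (fun τ : RawTerm m K => (pencilDet d S).coeff (rawSlope d τ) = 0)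
    (fun τ => rawCoef S τ * x ^ rawSlope d τ)
  rw [← hsplit, sum_deadClass_terms_eq_zero, zero_add, ← Finset.sum_filter_add_sum_filter_not univ
    (fun τ : RawTerm m K => (pencilDet d S).coeff (rawSlope d τ) = 0)
    (fun τ => (if (pencilDet d S).coeff (rawSlope d τ) = 0 then 0 else rawCoef S τ) * x ^ rawSlope d τ)]
  have h0 : ∑ τ ∈ univ.filter (fun τ : RawTerm m K => (pencilDet d S).coeff (rawSlope d τ) = 0),
      (if (pencilDet d S).coeff (rawSlope d τ) = 0 then 0 else rawCoef S τ) * x ^ rawSlope d τ = 0 :=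
    Finset.sum_eq_zero fun τ hτ => by rw [if_pos (mem_filter.1 hτ).2, zero_mul]
  rw [h0, zero_add]
  exact Finset.sum_congr rfl fun τ hτ => by rw [if_neg (mem_filter.1 hτ).2]

/-- **live-envelope confinement** (the archimedean half of dead-class lifting, PROVED): under `LiveDepthLE Δ` every nonzero real root of a
nonzero pencil determinant has `log₂|x|` within `m(⌊log₂(mK)⌋+1) + Δ` of a LIVE breakpoint. [folklore] -/
theorem root_near_liveBreaks (Δ : ℕ) (d : Fin K → ℕ) (S : Fin K → Matrix (Fin m) (Fin m) ℝ) (hΔ : LiveDepthLE d S Δ)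
    (x : ℝ) (hx0 : x ≠ 0) (hf0 : pencilDet d S ≠ 0) (hroot : (pencilDet d S).IsRoot x) :
    ∃ b ∈ liveBreaks d S, |Real.logb 2 |x| - b| ≤ ((m * (Nat.log 2 (m * K) + 1) + Δ : ℕ) : ℝ) := by
  classical
  set y := |x| with hy_def
  have hy : 0 < y := abs_pos.2 hx0
  have hyne : y ≠ 0 := hy.ne'
  set u := x / |x| with hu_def
  have hu : u = 1 ∨ u = -1 := sign_div_abs x hx0
  have huy : u * y = x := by rw [hu_def, hy_def]; exact div_mul_cancel₀ x (abs_ne_zero.2 hx0)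
  have hupow : ∀ n : ℕ, u ^ n = 1 ∨ u ^ n = -1 := fun n => by
    rcases hu with h | h
    · left; simp [h]
    · rw [h]; exact neg_one_pow_eq_or ℝ n
  -- live-masked raw data: dead-class terms are zeroed out
  let c : RawTerm m K → ℝ := fun τ => if (pencilDet d S).coeff (rawSlope d τ) = 0 then 0 else rawCoef S τ
  let a : RawTerm m K → ℝ := fun τ => |c τ|
  let sg : RawTerm m K → ℝ := fun τ => if c τ = 0 then 1 else c τ / |c τ| * u ^ rawSlope d τ
  have ha : ∀ τ, 0 ≤ a τ := fun τ => abs_nonneg _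
  have hsg : ∀ τ, sg τ = 1 ∨ sg τ = -1 := fun τ => by
    by_cases h : c τ = 0
    · left; simp [sg, h]
    · simp only [sg, if_neg h]
      rcases sign_div_abs _ h with h1 | h1 <;> rcases hupow (rawSlope d τ) with h2 | h2 <;> simp [h1, h2]
  have hF1 : ∀ τ, sg τ * a τ = c τ * u ^ rawSlope d τ := fun τ => by
    by_cases h : c τ = 0
    · simp [sg, a, h]
    · simp only [sg, a, if_neg h]
      field_simp
  have hF2 : ∀ τ, sg τ * a τ * y ^ rawSlope d τ = c τ * x ^ rawSlope d τ := fun τ => by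
    rw [hF1, mul_assoc, ← mul_pow, huy]
  -- live terms: `c = rawCoef`, and liveness in terms of `a`
  have hc_live : ∀ τ, (pencilDet d S).coeff (rawSlope d τ) ≠ 0 → c τ = rawCoef S τ := fun τ h => by simp [c, h]
  have hlive_of_a : ∀ τ, 0 < a τ → IsLiveTerm d S τ := by
    intro τ hτ
    have hcτ : c τ ≠ 0 := abs_pos.1 hτ
    by_cases h : (pencilDet d S).coeff (rawSlope d τ) = 0
    · exact absurd (by simp [c, h]) hcτ
    · exact ⟨by rwa [hc_live τ h] at hcτ, h⟩
  have ha_of_live : ∀ τ, IsLiveTerm d S τ → a τ = |rawCoef S τ| := fun τ h => by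
    show |c τ| = _; rw [hc_live τ h.2]
  -- root equation over live terms
  have hroot' : ∑ τ, sg τ * a τ * y ^ (rawSlope d τ) = 0 := by
    simp_rw [hF2]; rw [← eval_pencilDet_eq_sum_live]; exact hroot
  -- a live present term exists; the top live term τ₀
  obtain ⟨e₀, he₀⟩ : ∃ e, (pencilDet d S).coeff e ≠ 0 := by
    by_contra hall; push Not at hall
    exact hf0 (Polynomial.ext fun e => by simpa using hall e)
  obtain ⟨τp, hτpe, hτp⟩ : ∃ τ ∈ univ.filter (fun τ : RawTerm m K => rawSlope d τ = e₀), rawCoef S τ ≠ 0 := by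
    rw [coeff_pencilDet_eq_sum] at he₀
    exact Finset.exists_ne_zero_of_sum_ne_zero he₀
  have hτpe' : rawSlope d τp = e₀ := (mem_filter.1 hτpe).2
  have hap : 0 < a τp := by
    have h1 : (pencilDet d S).coeff (rawSlope d τp) ≠ 0 := by rw [hτpe']; exact he₀
    show 0 < |c τp|
    rw [hc_live τp h1]; exact abs_pos.2 hτp
  obtain ⟨τ₀, -, hmax⟩ := Finset.exists_max_image (univ : Finset (RawTerm m K)) (fun τ => a τ * y ^ rawSlope d τ) ⟨τp, mem_univ _⟩
  have hpos₀ : 0 < a τ₀ * y ^ rawSlope d τ₀ := (mul_pos hap (pow_pos hy _)).trans_le (hmax τp (mem_univ _))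
  have ha₀ : 0 < a τ₀ := by
    by_contra h; push Not at h
    have : a τ₀ * y ^ rawSlope d τ₀ ≤ 0 := mul_nonpos_of_nonpos_of_nonneg h (pow_pos hy _).le
    linarith
  have hlive₀ : IsLiveTerm d S τ₀ := hlive_of_a τ₀ ha₀
  -- one-class depth at the (live) class of τ₀
  have hclass : ∀ τ, rawSlope d τ = rawSlope d τ₀ → c τ = rawCoef S τ := fun τ h => hc_live τ (by rw [h]; exact hlive₀.2)
  have hdepth' : (∑ τ ∈ univ.filter (fun τ => rawSlope d τ = rawSlope d τ₀), a τ) ≤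
      (2 : ℝ) ^ Δ * |∑ τ ∈ univ.filter (fun τ => rawSlope d τ = rawSlope d τ₀), sg τ * a τ| := by
    have hL : (∑ τ ∈ univ.filter (fun τ => rawSlope d τ = rawSlope d τ₀), a τ) = classMass d S (rawSlope d τ₀) := by
      rw [classMass]
      exact Finset.sum_congr rfl fun τ hτ => by show |c τ| = _; rw [hclass τ (mem_filter.1 hτ).2]
    have hR : (∑ τ ∈ univ.filter (fun τ => rawSlope d τ = rawSlope d τ₀), sg τ * a τ) =
        u ^ rawSlope d τ₀ * (pencilDet d S).coeff (rawSlope d τ₀) := by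
      rw [coeff_pencilDet_eq_sum, Finset.mul_sum]
      refine Finset.sum_congr rfl fun τ hτ => ?_
      rw [hF1, hclass τ (mem_filter.1 hτ).2, (Finset.mem_filter.1 hτ).2, mul_comm]
    rw [hL, hR, abs_mul]
    have : |u ^ rawSlope d τ₀| = 1 := by rcases hupow (rawSlope d τ₀) with h | h <;> simp [h]
    rw [this, one_mul]
    exact hΔ _ hlive₀.2
  obtain ⟨τ₁, hs₁, hconf⟩ := rawConfinement_oneClass (rawSlope d) a ha sg hsg Δ y hy hroot' τ₀ ha₀ hdepth'
  set N := Fintype.card (RawTerm m K) with hN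
  have hNpos : 0 < (N : ℝ) := by
    have : 0 < N := Fintype.card_pos_iff.2 ⟨τ₀⟩
    exact_mod_cast this
  have ha₁ : 0 < a τ₁ := by
    by_contra h; push Not at h
    have h0 : a τ₁ = 0 := le_antisymm h (ha τ₁)
    rw [h0, zero_mul, mul_zero] at hconf
    linarith
  have hlive₁ : IsLiveTerm d S τ₁ := hlive_of_a τ₁ ha₁
  -- pass to logs over LIVE terms
  let ι := {τ : RawTerm m K // IsLiveTerm d S τ}
  set θ := Real.logb 2 y with hθ
  have hlog_line : ∀ τ : RawTerm m K, IsLiveTerm d S τ →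
      Real.logb 2 (a τ * y ^ rawSlope d τ) = rawLog S τ + (rawSlope d τ : ℤ) * θ := by
    intro τ hτ
    rw [ha_of_live τ hτ, Real.logb_mul (abs_pos.2 hτ.1).ne' (pow_ne_zero _ hyne), Real.logb_pow, rawLog]
    push_cast; ring
  have htop : ∀ k : ι, rawLog S k.1 + (rawSlope d k.1 : ℤ) * θ ≤ rawLog S τ₀ + (rawSlope d τ₀ : ℤ) * θ := by
    intro k
    rw [← hlog_line k.1 k.2, ← hlog_line τ₀ hlive₀]
    have hk : 0 < a k.1 := by rw [ha_of_live k.1 k.2]; exact abs_pos.2 k.2.1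
    exact Real.logb_le_logb_of_le (by norm_num) (mul_pos hk (pow_pos hy _)) (hmax k.1 (mem_univ _))
  have hnear : rawLog S τ₀ + (rawSlope d τ₀ : ℤ) * θ ≤ rawLog S τ₁ + (rawSlope d τ₁ : ℤ) * θ + (Real.logb 2 N + Δ) := by
    rw [← hlog_line τ₀ hlive₀, ← hlog_line τ₁ hlive₁]
    have h1 := Real.logb_le_logb_of_le (b := 2) (by norm_num) hpos₀ hconf
    have h2 : Real.logb 2 (N * (2 : ℝ) ^ Δ * (a τ₁ * y ^ rawSlope d τ₁)) =
        Real.logb 2 N + Δ + Real.logb 2 (a τ₁ * y ^ rawSlope d τ₁) := by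
      rw [Real.logb_mul (by positivity) (mul_pos ha₁ (pow_pos hy _)).ne', Real.logb_mul hNpos.ne' (by positivity),
        Real.logb_pow, Real.logb_self_eq_one (by norm_num)]
      ring
    linarith
  have hs₁' : ((rawSlope d τ₀ : ℕ) : ℤ) ≠ ((rawSlope d τ₁ : ℕ) : ℤ) := by exact_mod_cast (Ne.symm hs₁)
  obtain ⟨b, hb, k, l, hkl, htie, hall⟩ := envelopeGap (ι := ι) (fun t => (rawSlope d t.1 : ℤ)) (fun t => rawLog S t.1)
    (Real.logb 2 N + Δ) θ ⟨τ₀, hlive₀⟩ ⟨τ₁, hlive₁⟩ hs₁' htop hnear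
  have hkl' : (rawSlope d k.1 : ℝ) ≠ rawSlope d l.1 := by
    intro h; apply hkl; exact_mod_cast (show rawSlope d k.1 = rawSlope d l.1 by exact_mod_cast h)
  have hbcross : rawCross d S (k.1, l.1) = b := by
    rw [rawCross]
    have htie' : rawLog S k.1 + (rawSlope d k.1 : ℝ) * b = rawLog S l.1 + (rawSlope d l.1 : ℝ) * b := by
      simpa [Int.cast_natCast] using htie
    rw [div_eq_iff (sub_ne_zero.2 (Ne.symm hkl'))]
    linarith
  refine ⟨b, ?_, ?_⟩
  · rw [liveBreaks, Finset.mem_image]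
    refine ⟨(k.1, l.1), ?_, hbcross⟩
    rw [Finset.mem_filter]
    refine ⟨mem_univ _, k.2, l.2, fun h => hkl (by exact_mod_cast h), fun t ht => ?_⟩
    rw [hbcross]
    have := hall ⟨t, ht⟩
    simpa [rawLine, Int.cast_natCast] using this
  · calc |θ - b| ≤ Real.logb 2 N + Δ := hb
      _ ≤ (m * (Nat.log 2 (m * K) + 1) : ℕ) + Δ := by
          have hc := card_rawTerm_le m K
          have h1 : (N : ℝ) ≤ (2 : ℝ) ^ (m * (Nat.log 2 (m * K) + 1)) := by rw [hN]; exact_mod_cast hc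
          have h2 := Real.logb_le_logb_of_le (b := 2) (by norm_num) hNpos h1
          rw [Real.logb_pow, Real.logb_self_eq_one (by norm_num), mul_one] at h2
          push_cast at h2 ⊢
          linarith
      _ = ((m * (Nat.log 2 (m * K) + 1) + Δ : ℕ) : ℝ) := by push_cast; ring

/-- **octaves against the live envelope** (PROVED): under `LiveDepthLE Δ`, `octaveCount ≤ (2(M+Δ)+2) · #liveBreaks`. -/
theorem octaveCount_le_liveBreaks (Δ : ℕ) (d : Fin K → ℕ) (S : Fin K → Matrix (Fin m) (Fin m) ℝ) (hΔ : LiveDepthLE d S Δ) :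
    octaveCount (pencilDet d S) ≤ (2 * (m * (Nat.log 2 (m * K) + 1) + Δ) + 2) * (liveBreaks d S).card :=
  cellCount_proof (pencilDet d S) (liveBreaks d S) (m * (Nat.log 2 (m * K) + 1) + Δ)
    fun x hx hp hr => root_near_liveBreaks Δ d S hΔ x hx hp hr

/-- **reduction** (PROVED): the live-breaks bound would give dead-class lifting with the rung's bound. -/
theorem deadClassLifting_of_liveBreaksBound (h : LiveBreaksBound) : DeadClassLifting := by
  intro m K n Δ hT d S hΔ
  have hB : (liveBreaks d S).card ≤ n := h m K n hT d S
  calc octaveCount (pencilDet d S) ≤ (2 * (m * (Nat.log 2 (m * K) + 1) + Δ) + 2) * (liveBreaks d S).card :=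
        octaveCount_le_liveBreaks Δ d S hΔ
    _ ≤ (2 * (m * (Nat.log 2 (m * K) + 1) + Δ) + 2) * n := Nat.mul_le_mul_left _ hB
    _ ≤ (2 * (m * (Nat.log 2 (m * K) + 1) + Δ) + 3) * (n + 1) := Nat.mul_le_mul (Nat.le_succ _) (Nat.le_succ _)

end LiveEnvelope

end Summit.ValiantsHypothesis.ValiantsHypothesis.Theorems.KPlusLogSqLaw.Octave
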